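import Summits.HodgeConjecture.HodgeConjecture.Theses.HeckePrymWeil
import Summits.HodgeConjecture.HodgeConjecture.Theorems.HeckePrymWeilAimedDescendingProof
import HarnessLib

/-!
# Strategy census sketch — crux `HeckePrymWeil.WeilTenfoldsSqrtMinus11` (stmt-HodgeConjecture-1262)

Crux-strategist `planner-cstrat-stmt-HodgeConjecture-1262-s1-0`, 2026-08-17.  Companion of
`Cruxes/WeilTenfoldsSqrtMinus11/STRATEGY-CENSUS.md`; it TYPES the two statements the census uses and
proves the two logical facts it claims about them.  No `sorry`.

* §1 STRENGTHEN.  `HyperbolicTwelvefoldsSqrtMinus11` — the Hodge–Weil classes are algebraic on every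
  SPLIT (hyperbolic for the `K`-symmetrised hyperplane class) `ℚ(√-11)`-Weil abelian TWELVEFOLD — typed
  verbatim as the split-rung hypothesis of the route's support item `AimedDescending` at
  `(p, n) = (11, 5)`, `m = 6` (same shape as the route crux `HyperbolicEightfoldsSqrtMinus7` at
  `(7, 4)`).  THEOREM `weilTenfolds_of_hyperbolicTwelvefolds`: it implies the crux, by the route's
  PROVED `Theorems.aimedDescending_proof` (item stmt-14643, closed; the aiming CM Weil surface is
  constructed in the tree).  So the crux is reduced, unconditionally and in the tree, to ONE
  component of the `ℚ(√-11)` twelvefold moduli — the component that contains the tensor anchors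
  `X × X̂` (every abelian sixfold `X`), the `SL₂(𝔽₁₁)`-Pryms and the totally degenerate cusps.
* §2 DECOMPOSITION (typed, trivial seam).  `HyperbolicTenfoldsSqrtMinus11` (split component, where
  Markman's `n = 5` tensor anchors `X₅ × X̂₅` and the Hecke–Pryms `P(11,2)` live) and its literal
  complement `NonHyperbolicTenfoldsSqrtMinus11`; THEOREM `weilTenfolds_of_hyperbolic_of_nonHyperbolic`
  (case split) and the converse projections (each piece is a consequence of the crux).  Recorded, NOT
  filed as a route split: after the strategist's no-go for split anchor objects
  (`SplitObjectsNoGo.md`) the non-hyperbolic piece has no anchor object of its own and is reached only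
  through §1, which already covers both pieces.

[cite: Markman2025SurveySecant, §11.5 Step 2] [cite: Schoen1998HodgeWeilAddendum, §10]
[cite: vanGeemen1994HodgeAV, Lemma 5.2 (3) and 5.4]
-/

noncomputable section

-- single-problem summit (Problem = Summit): the mandated namespace repeats `HodgeConjecture`.
set_option linter.dupNamespace false

open CategoryTheory
open Literature.AlgebraicGeometry Literature.AlgebraicGeometry.Motives
  Literature.AlgebraicGeometry.HodgeTheory
open Summit.HodgeConjecture.HodgeConjecture.Theses.HeckePrymWeil

namespace Summit.HodgeConjecture.HodgeConjecture.Cruxes.WeilTenfoldsSqrtMinus11.StrategyCensus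

/-! ## §1 Strengthen: split `ℚ(√-11)` twelvefolds imply the crux (proved reduction) -/

/-- **S⁺ = split `ℚ(√-11)`-Weil TWELVEFOLDS.**  On every complex abelian twelvefold `A` with
`φ ≫ φ = -11` and a projective embedding `e : A.X ⟶ ℙᴺ` with a rational `a ≠ 0` in `H²(ℙᴺ)` such that
`(A, φ, h)` is of HYPERBOLIC Weil type for the `K`-symmetrised hyperplane class
`h = 11·e^*a + φ^*e^*a` (`Motives.IsHyperbolicWeilType A φ 6 h`: a `φ^*`-stable rational
`Q_h`-Lagrangian 12-frame of `H¹`, i.e. `det H = (-1)⁶ = +1`, the split component), every rational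
`(6,6)`-class of the Weil plane `Eig((𝟙+φ)^*, (1+i√11)¹²) ⊔ Eig((𝟙+φ)^*, (1-i√11)¹²)` is algebraic.
This is the hypothesis of `AimedDescending` at `(p, n) = (11, 5)`, `m = 6`, verbatim.
[cite: vanGeemen1994HodgeAV, Lemma 5.2 (3) and 5.4] [cite: Markman2025SurveySecant, §11.5 Step 2] -/
def HyperbolicTwelvefoldsSqrtMinus11 : Prop :=
  ∀ (A : AbelianVariety ℂ) (φ : A ⟶ A), A.dim = 12 → φ ≫ φ = -((11 : ℤ) • 𝟙 A) →
    ∀ (e : ProjectiveEmbedding A.X) (a : complexBetti (projectiveSpace e.n ℂ) 2),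
      IsRationalClass a → a ≠ 0 →
      IsHyperbolicWeilType A φ 6
        ((11 : ℂ) • complexBetti.map e.ι 2 a + complexBetti.map φ.hom.hom.hom 2 (complexBetti.map e.ι 2 a)) →
      ∀ c : complexBetti A.X 12, IsRationalClass c → IsOfHodgeType 12 A.X 12 6 6 c →
        c ∈ Module.End.eigenspace (complexBetti.map (𝟙 A + φ).hom.hom.hom 12).hom
              ((1 + Complex.I * (Real.sqrt (11 : ℝ) : ℂ)) ^ 12) ⊔
            Module.End.eigenspace (complexBetti.map (𝟙 A + φ).hom.hom.hom 12).hom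
              ((1 - Complex.I * (Real.sqrt (11 : ℝ) : ℂ)) ^ 12) →
        c ∈ algebraicClasses A.X 6

/-- **The crux from split twelvefolds** — `HyperbolicTwelvefoldsSqrtMinus11 → WeilTenfoldsSqrtMinus11`,
by the route's PROVED aimed component descent (`Theorems.aimedDescending_proof`, item stmt-14643)
instantiated at `(p, n) = (11, 5)`: `11` is prime, `11 % 4 = 3`, `7 ≤ 11`, `1 ≤ 5`, and the two rung
predicates agree definitionally (`2 * (5 + 1) = 12`, `2 * 5 = 10`, `((11 : ℕ) : ℤ) = 11`, …, all `rfl`).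
[cite: Markman2025SurveySecant, §11.5 Step 2] [cite: Schoen1998HodgeWeilAddendum, §10] -/
theorem weilTenfolds_of_hyperbolicTwelvefolds (h12 : HyperbolicTwelvefoldsSqrtMinus11) :
    WeilTenfoldsSqrtMinus11 := by
  have hAD : AimedDescending := Summit.HodgeConjecture.HodgeConjecture.Theorems.aimedDescending_proof
  unfold WeilTenfoldsSqrtMinus11
  unfold HyperbolicTwelvefoldsSqrtMinus11 at h12
  unfold AimedDescending at hAD
  intro A φ hdim hφ c hc hH hW
  refine hAD 11 (by norm_num) (by norm_num) (by norm_num) 5 (by norm_num) ?_ A φ hdim hφ c hc hH hW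
  intro m hm A' φ' hdim' hφ' e a ha ha0 hhyp c' hc' hH' hW'
  subst hm
  exact h12 A' φ' hdim' hφ' e a ha ha0 hhyp c' hc' hH' hW'

/-! ## §2 Decomposition (typed): the split tenfold component and its complement -/

/-- **Sub₁ = split `ℚ(√-11)`-Weil TENFOLDS** (the `δ ≡ -1` component: contains `X₅ × X̂₅` for every
abelian fivefold `X₅` with Markman's secant `K`-structure, the Hecke–Pryms `P(11,2)` and the balanced
undecic pencil), typed as `HyperbolicEightfoldsSqrtMinus7` is at `(7, 4)`.
[cite: vanGeemen1994HodgeAV, Lemma 5.2 (3) and 5.4] [cite: Markman2025SecantWeil, §1.2 and Thm. 1.5.1] -/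
def HyperbolicTenfoldsSqrtMinus11 : Prop :=
  ∀ (A : AbelianVariety ℂ) (φ : A ⟶ A), A.dim = 10 → φ ≫ φ = -((11 : ℤ) • 𝟙 A) →
    ∀ (e : ProjectiveEmbedding A.X) (a : complexBetti (projectiveSpace e.n ℂ) 2),
      IsRationalClass a → a ≠ 0 →
      IsHyperbolicWeilType A φ 5
        ((11 : ℂ) • complexBetti.map e.ι 2 a + complexBetti.map φ.hom.hom.hom 2 (complexBetti.map e.ι 2 a)) →
      ∀ c : complexBetti A.X 10, IsRationalClass c → IsOfHodgeType 10 A.X 10 5 5 c →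
        c ∈ Module.End.eigenspace (complexBetti.map (𝟙 A + φ).hom.hom.hom 10).hom
              ((1 + Complex.I * (Real.sqrt (11 : ℝ) : ℂ)) ^ 10) ⊔
            Module.End.eigenspace (complexBetti.map (𝟙 A + φ).hom.hom.hom 10).hom
              ((1 - Complex.I * (Real.sqrt (11 : ℝ) : ℂ)) ^ 10) →
        c ∈ algebraicClasses A.X 5

/-- **Sub₂ = the literal complement**: `ℚ(√-11)`-Weil tenfolds `(A, φ)` admitting NO projective
embedding whose `K`-symmetrised hyperplane class is hyperbolic (for `(A, φ)` of Weil type `(5,5)`: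
the non-split components `det H ≢ -1`; off Weil type the rung predicate is vacuous anyway). -/
def NonHyperbolicTenfoldsSqrtMinus11 : Prop :=
  ∀ (A : AbelianVariety ℂ) (φ : A ⟶ A), A.dim = 10 → φ ≫ φ = -((11 : ℤ) • 𝟙 A) →
    (∀ (e : ProjectiveEmbedding A.X) (a : complexBetti (projectiveSpace e.n ℂ) 2),
      IsRationalClass a → a ≠ 0 →
      ¬ IsHyperbolicWeilType A φ 5
        ((11 : ℂ) • complexBetti.map e.ι 2 a + complexBetti.map φ.hom.hom.hom 2 (complexBetti.map e.ι 2 a))) →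
      ∀ c : complexBetti A.X 10, IsRationalClass c → IsOfHodgeType 10 A.X 10 5 5 c →
        c ∈ Module.End.eigenspace (complexBetti.map (𝟙 A + φ).hom.hom.hom 10).hom
              ((1 + Complex.I * (Real.sqrt (11 : ℝ) : ℂ)) ^ 10) ⊔
            Module.End.eigenspace (complexBetti.map (𝟙 A + φ).hom.hom.hom 10).hom
              ((1 - Complex.I * (Real.sqrt (11 : ℝ) : ℂ)) ^ 10) →
        c ∈ algebraicClasses A.X 5

/-- **Glue of the typed split (trivial seam: excluded middle on hyperbolicity).** [folklore] -/
theorem weilTenfolds_of_hyperbolic_of_nonHyperbolic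
    (h₁ : HyperbolicTenfoldsSqrtMinus11) (h₂ : NonHyperbolicTenfoldsSqrtMinus11) :
    WeilTenfoldsSqrtMinus11 := by
  intro A φ hdim hφ c hc hH hW
  by_cases hsplit : ∃ (e : ProjectiveEmbedding A.X) (a : complexBetti (projectiveSpace e.n ℂ) 2),
      IsRationalClass a ∧ a ≠ 0 ∧
      IsHyperbolicWeilType A φ 5
        ((11 : ℂ) • complexBetti.map e.ι 2 a + complexBetti.map φ.hom.hom.hom 2 (complexBetti.map e.ι 2 a))
  · obtain ⟨e, a, ha, ha0, hhyp⟩ := hsplit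
    exact h₁ A φ hdim hφ e a ha ha0 hhyp c hc hH hW
  · push_neg at hsplit
    exact h₂ A φ hdim hφ (fun e a ha ha0 => hsplit e a ha ha0) c hc hH hW

/-- Each piece is a consequence of the crux (so neither is the crux on its own only if it is also
strictly weaker — which is the open mathematics: both components are non-empty). [folklore] -/
theorem hyperbolicTenfolds_of_weilTenfolds (h : WeilTenfoldsSqrtMinus11) :
    HyperbolicTenfoldsSqrtMinus11 :=
  fun A φ hdim hφ _ _ _ _ _ c hc hH hW => h A φ hdim hφ c hc hH hW

/-- The complement piece is a consequence of the crux. [folklore] -/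
theorem nonHyperbolicTenfolds_of_weilTenfolds (h : WeilTenfoldsSqrtMinus11) :
    NonHyperbolicTenfoldsSqrtMinus11 :=
  fun A φ hdim hφ _ c hc hH hW => h A φ hdim hφ c hc hH hW

/-- Split twelvefolds already give the split TENFOLD piece (and everything else): the strengthening
dominates the decomposition. [folklore] -/
theorem hyperbolicTenfolds_of_hyperbolicTwelvefolds (h12 : HyperbolicTwelvefoldsSqrtMinus11) :
    HyperbolicTenfoldsSqrtMinus11 :=
  hyperbolicTenfolds_of_weilTenfolds (weilTenfolds_of_hyperbolicTwelvefolds h12)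

/-! ## §3 Read-back: the reduction concludes the crux BY NAME -/

example (h12 : HyperbolicTwelvefoldsSqrtMinus11) :
    Summit.HodgeConjecture.HodgeConjecture.Theses.HeckePrymWeil.WeilTenfoldsSqrtMinus11 :=
  weilTenfolds_of_hyperbolicTwelvefolds h12

end Summit.HodgeConjecture.HodgeConjecture.Cruxes.WeilTenfoldsSqrtMinus11.StrategyCensus

end
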